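import Mathlib
import HarnessLib

/-!
# Telling two coins apart: Le Cam's lower bound in counting form (Bhattacharyya / Hellinger)

Trunk T-CPLX-CORE, beside `SamplingChernoff.lean` / `SamplingDeviation.lean` (which bound how FEW
samples suffice). This file bounds how MANY are necessary (and, since v1.3, how many SUFFICE for the
count test): no event on `m` independent tosses
separates a `p`-coin from a `q`-coin by more than `√(2m(1 − BC(p,q)))`, where
`BC(p,q) = √(pq) + √((1−p)(1−q))` is the Bhattacharyya coefficient (affinity) of the two coins and
`1 − BC` their squared Hellinger distance (un-normalised convention `d_H² = 2 − 2·BC` up to the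
factor 2). Everything is a finite sum over `Fin m → Bool` with the explicit product weights
`∏ i, (if x i then p else 1 − p)`; no measure theory, theorems only.

* `sum_sqrtWeight_mul` — the affinity of the `m`-fold products is `BC^m` (product rule; private
  helpers: the weights are a probability vector, square-root weights, `0 ≤ BC ≤ 1`);
* `coin_event_diff_sq_le` — **Le Cam**: `(P_p^m(E) − P_q^m(E))² ≤ 1 − BC^{2m}` for every event `E`
  (Cauchy–Schwarz on `|a² − b²| = |a − b|(a + b)` for the square-root weights);
* `coin_event_diff_sq_le_mul` — hence `≤ 2m(1 − BC)` (Bernoulli's inequality);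
* `coin_samples_ge`, `coin_samples_ge_third` — the sample-size reading: advantage `≥ γ` forces
  `γ² ≤ 2m(1 − BC)`; advantage `≥ 1/3` forces `1 ≤ 18·m·(1 − BC)`.
* (v1.3, independent NOT necessarily identical trials with head probabilities `v i`, weights
  `∏ i, (if x i then v i else 1 − v i)`): `sum_trialWeight_eq_one`, `sum_trialWeight_mul_exp` (the
  exponential moment of the number of heads factorises), `prod_trialMGF_le_exp` /
  `prod_trialMGF_neg_le_exp`, `trials_upperTail_le` / `trials_lowerTail_le` (Chernoff's method),
  `trials_count_upper_le_third` (SOUNDNESS of the middle-threshold count test when all `v i ≤ q`),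
  `trials_count_lower_le_third` / `trials_count_pass_ge_two_thirds` (COMPLETENESS when all
  `v i ≥ p`), **`coin_count_advantage_ge_third`** (two coins) — the CONVERSE direction: for
  `0 < q < p ≤ 5q`, `p ≤ 1`, `m ≥ 16·p·ln 3/(p − q)²` trials suffice (matching
  `coin_samples_ge_third` up to the constant when `p ≍ q`).

The proofs follow Ghosal–van der Vaart, Lemma B.1 (i) (`‖p − q‖₁ ≤ d_H √(4 − d_H²)`, by the
factorisation `|p − q| = |√p − √q|(√p + √q)` and Cauchy–Schwarz), Lemma B.8 (ii) (the affinity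
of product densities is the product of the affinities) and B.8 (iii) (sub-additivity of `d_H²`
over products, via `∏ (1 − xᵢ) ≥ 1 − Σ xᵢ`), specialised to two-point spaces. Used by
the certified-randomness census of cell qa-cr (how many parallel repetitions a count-threshold
amplification of a fine-gap Arthur–Merlin round needs); independent of everything else.
In-tree sibling (PMF form; cited, not restated): `PMF.bcCoeff` and Le Cam's inequality
`PMF.tvDist_le_sqrt_one_sub_bcCoeff_sq` (`Δ(p, q) ≤ √(1 − BC(p, q)²)`) of
`Literature/Computability/Cryptography/StatisticalDistanceBhattacharyya.lean`; the present file is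
the finite-product counting form with explicit weights (no `PMF`, no `tsum`), plus the product
rule and the sample-size reading.

## References

* [GhosalVandervaart2017] S. Ghosal, A. van der Vaart, *Fundamentals of Nonparametric Bayesian
  Inference*, CUP 2017, App. B: (B.1) and Lemma B.1 (i) (p. 714–715), Lemma B.8 (ii), (iii)
  (p. 721) [held: corpus book:ghosal2017-fundamentals-nonparametric-bayesian-inference].
* L. Le Cam, *Convergence of estimates under dimensionality restrictions*, Ann. Statist. 1 (1973)
  (the two-point method).
* [Canonne2020] C. Canonne, *A survey on distribution testing*, Theory of Computing Graduate
  Surveys 9 (2020) (the `Θ(1/ε²)` coin-distinguishing folklore and the Hellinger toolkit).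
* [MotwaniRaghavan1995] R. Motwani, P. Raghavan, *Randomized Algorithms*, CUP 1995, §4.1,
  Theorems 4.1–4.2 (Chernoff bounds for sums of independent indicator variables via the moment
  generating function and Markov's inequality) — the v1.3 section, in this file's finite-sum form
  (cf. the tree's `Literature.Probability.Independence.ChernoffCount.*`, counting form over `ι → X`).
-/

namespace Literature.Computability.Complexity

open Finset Real

/-- The `p`-coin weights sum to one over all sequences. [folklore] -/
private theorem sum_coinWeight_eq_one (m : ℕ) (p : ℝ) :
    ∑ x : Fin m → Bool, ∏ i, (if x i then p else 1 - p) = 1 := by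
  have h := (Finset.prod_univ_sum (fun (_ : Fin m) => (univ : Finset Bool))
    (fun _ b => if b then p else 1 - p))
  rw [Fintype.piFinset_univ] at h
  rw [← h]
  simp

/-- The square-root weights multiply to the Bhattacharyya coefficient to the power `m` (the
affinity of product densities is the product of the affinities).
[cite: GhosalVandervaart2017, Lemma B.8(ii)] -/
theorem sum_sqrtWeight_mul (m : ℕ) (p q : ℝ) :
    ∑ x : Fin m → Bool, (∏ i, (if x i then sqrt p else sqrt (1 - p))) *
        (∏ i, (if x i then sqrt q else sqrt (1 - q))) =
      (sqrt p * sqrt q + sqrt (1 - p) * sqrt (1 - q)) ^ m := by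
  have h := (Finset.prod_univ_sum (fun (_ : Fin m) => (univ : Finset Bool))
    (fun _ b => if b then sqrt p * sqrt q else sqrt (1 - p) * sqrt (1 - q)))
  rw [Fintype.piFinset_univ] at h
  have h' : (sqrt p * sqrt q + sqrt (1 - p) * sqrt (1 - q)) ^ m =
      ∑ x : Fin m → Bool, ∏ i, (if x i then sqrt p * sqrt q else sqrt (1 - p) * sqrt (1 - q)) := by
    simpa using h
  rw [h']
  refine Finset.sum_congr rfl fun x _ => ?_
  rw [← Finset.prod_mul_distrib]
  refine Finset.prod_congr rfl fun i _ => ?_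
  split_ifs <;> rfl

/-- The square-root weight squares to the weight (`0 ≤ p ≤ 1`). [folklore] -/
private theorem sqrtWeight_sq (m : ℕ) {p : ℝ} (hp : 0 ≤ p) (hp1 : p ≤ 1) (x : Fin m → Bool) :
    (∏ i, (if x i then sqrt p else sqrt (1 - p))) ^ 2 = ∏ i, (if x i then p else 1 - p) := by
  rw [← Finset.prod_pow]
  refine Finset.prod_congr rfl fun i _ => ?_
  split_ifs
  · exact Real.sq_sqrt hp
  · exact Real.sq_sqrt (by linarith)

/-- The square-root weight is nonnegative. [folklore] -/
private theorem sqrtWeight_nonneg (m : ℕ) (p : ℝ) (x : Fin m → Bool) :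
    0 ≤ ∏ i, (if x i then sqrt p else sqrt (1 - p)) :=
  Finset.prod_nonneg fun i _ => by split_ifs <;> exact Real.sqrt_nonneg _

/-- The Bhattacharyya coefficient of two coins is at most one (AM–GM). [folklore] -/
private theorem bhatt_le_one {p q : ℝ} (hp : 0 ≤ p) (hp1 : p ≤ 1) (hq : 0 ≤ q) (hq1 : q ≤ 1) :
    sqrt p * sqrt q + sqrt (1 - p) * sqrt (1 - q) ≤ 1 := by
  have h1 : sqrt p * sqrt q ≤ (p + q) / 2 := by
    have := two_mul_le_add_sq (sqrt p) (sqrt q)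
    rw [Real.sq_sqrt hp, Real.sq_sqrt hq] at this
    linarith
  have h2 : sqrt (1 - p) * sqrt (1 - q) ≤ ((1 - p) + (1 - q)) / 2 := by
    have := two_mul_le_add_sq (sqrt (1 - p)) (sqrt (1 - q))
    rw [Real.sq_sqrt (by linarith), Real.sq_sqrt (by linarith)] at this
    linarith
  linarith

/-- The Bhattacharyya coefficient of two coins is nonnegative. [folklore] -/
private theorem bhatt_nonneg (p q : ℝ) : 0 ≤ sqrt p * sqrt q + sqrt (1 - p) * sqrt (1 - q) := by
  positivity

/-- **Le Cam's inequality for two coins, `m` tosses, squared form.** For every event `E` on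
`m` tosses, `(P_p^m(E) − P_q^m(E))² ≤ 1 − BC(p,q)^{2m}` where `BC(p,q) = √(pq) + √((1−p)(1−q))`
is the Bhattacharyya coefficient (`‖P − Q‖₁ ≤ d_H √(4 − d_H²)` with `d_H² = 2 − 2·BC^m`, read on
one event). [cite: GhosalVandervaart2017, Lemma B.1(i)] -/
theorem coin_event_diff_sq_le (m : ℕ) {p q : ℝ} (hp : 0 ≤ p) (hp1 : p ≤ 1) (hq : 0 ≤ q)
    (hq1 : q ≤ 1) (E : Finset (Fin m → Bool)) :
    (∑ x ∈ E, ∏ i, (if x i then p else 1 - p) - ∑ x ∈ E, ∏ i, (if x i then q else 1 - q)) ^ 2 ≤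
      1 - ((sqrt p * sqrt q + sqrt (1 - p) * sqrt (1 - q)) ^ m) ^ 2 := by
  -- abbreviations
  set a : (Fin m → Bool) → ℝ := fun x => ∏ i, (if x i then sqrt p else sqrt (1 - p)) with ha
  set b : (Fin m → Bool) → ℝ := fun x => ∏ i, (if x i then sqrt q else sqrt (1 - q)) with hb
  have hwa : ∀ x, ∏ i, (if x i then p else 1 - p) = a x ^ 2 :=
    fun x => (sqrtWeight_sq m hp hp1 x).symm
  have hwb : ∀ x, ∏ i, (if x i then q else 1 - q) = b x ^ 2 :=
    fun x => (sqrtWeight_sq m hq hq1 x).symm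
  have ha0 : ∀ x, 0 ≤ a x := fun x => sqrtWeight_nonneg m p x
  have hb0 : ∀ x, 0 ≤ b x := fun x => sqrtWeight_nonneg m q x
  have hA : ∑ x, a x * b x = (sqrt p * sqrt q + sqrt (1 - p) * sqrt (1 - q)) ^ m :=
    sum_sqrtWeight_mul m p q
  have hsa : ∑ x, a x ^ 2 = 1 := by
    have := sum_coinWeight_eq_one m p; simpa [hwa] using this
  have hsb : ∑ x, b x ^ 2 = 1 := by
    have := sum_coinWeight_eq_one m q; simpa [hwb] using this
  simp_rw [hwa, hwb]
  -- 2·(P(E) − Q(E)) = Σ_E (a²−b²) − Σ_{Eᶜ} (a²−b²)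
  have hsplit : ∑ x ∈ E, (a x ^ 2 - b x ^ 2) + ∑ x ∈ Eᶜ, (a x ^ 2 - b x ^ 2) = 0 := by
    rw [Finset.sum_add_sum_compl, Finset.sum_sub_distrib, hsa, hsb, sub_self]
  have hE : ∑ x ∈ E, a x ^ 2 - ∑ x ∈ E, b x ^ 2 = ∑ x ∈ E, (a x ^ 2 - b x ^ 2) := by
    rw [Finset.sum_sub_distrib]
  -- |Σ_S (a²−b²)| ≤ Σ_S |a−b|(a+b)
  have habs : ∀ S : Finset (Fin m → Bool),
      |∑ x ∈ S, (a x ^ 2 - b x ^ 2)| ≤ ∑ x ∈ S, |a x - b x| * (a x + b x) := by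
    intro S
    refine (Finset.abs_sum_le_sum_abs _ _).trans (Finset.sum_le_sum fun x _ => ?_)
    rw [show a x ^ 2 - b x ^ 2 = (a x - b x) * (a x + b x) by ring, abs_mul,
      abs_of_nonneg (by linarith [ha0 x, hb0 x] : 0 ≤ a x + b x)]
  -- hence 2|P(E)−Q(E)| ≤ Σ_univ |a−b|(a+b)
  have h2 : 2 * |∑ x ∈ E, (a x ^ 2 - b x ^ 2)| ≤ ∑ x, |a x - b x| * (a x + b x) := by
    have hc : |∑ x ∈ Eᶜ, (a x ^ 2 - b x ^ 2)| = |∑ x ∈ E, (a x ^ 2 - b x ^ 2)| := by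
      rw [show ∑ x ∈ Eᶜ, (a x ^ 2 - b x ^ 2) = -∑ x ∈ E, (a x ^ 2 - b x ^ 2) by linarith,
        abs_neg]
    have := Finset.sum_add_sum_compl E (fun x => |a x - b x| * (a x + b x))
    rw [← this]
    linarith [habs E, habs Eᶜ]
  -- Cauchy–Schwarz: (Σ |a−b|(a+b))² ≤ Σ(a−b)² · Σ(a+b)² = (2 − 2A)(2 + 2A)
  have hCS := Finset.sum_mul_sq_le_sq_mul_sq (univ : Finset (Fin m → Bool))
    (fun x => |a x - b x|) (fun x => a x + b x)
  have hd : ∑ x, |a x - b x| ^ 2 = 2 - 2 * ∑ x, a x * b x := by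
    simp_rw [sq_abs, sub_sq]
    rw [Finset.sum_add_distrib, Finset.sum_sub_distrib, hsa, hsb]
    simp_rw [mul_assoc]
    rw [← Finset.mul_sum]
    ring
  have hs : ∑ x, (a x + b x) ^ 2 = 2 + 2 * ∑ x, a x * b x := by
    simp_rw [add_sq]
    rw [Finset.sum_add_distrib, Finset.sum_add_distrib, hsa, hsb]
    simp_rw [mul_assoc]
    rw [← Finset.mul_sum]
    ring
  rw [hd, hs, hA] at hCS
  rw [hE]
  nlinarith [hCS, h2, abs_nonneg (∑ x ∈ E, (a x ^ 2 - b x ^ 2)),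
    sq_abs (∑ x ∈ E, (a x ^ 2 - b x ^ 2))]

/-- **Two-coin distinguishing lower bound (counting/weight form).** For every event `E` on `m`
tosses, `(P_p^m(E) − P_q^m(E))² ≤ 2m·(1 − BC(p,q))`: any test telling a `p`-coin from a `q`-coin
with advantage `≥ γ` needs `m ≥ γ²/(2(1 − BC))` tosses (sub-additivity of the squared Hellinger
distance over products, `1 − BC^m ≤ m(1 − BC)`). [cite: GhosalVandervaart2017, Lemma B.8(iii)] -/
theorem coin_event_diff_sq_le_mul (m : ℕ) {p q : ℝ} (hp : 0 ≤ p) (hp1 : p ≤ 1) (hq : 0 ≤ q)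
    (hq1 : q ≤ 1) (E : Finset (Fin m → Bool)) :
    (∑ x ∈ E, ∏ i, (if x i then p else 1 - p) - ∑ x ∈ E, ∏ i, (if x i then q else 1 - q)) ^ 2 ≤
      2 * m * (1 - (sqrt p * sqrt q + sqrt (1 - p) * sqrt (1 - q))) := by
  refine (coin_event_diff_sq_le m hp hp1 hq hq1 E).trans ?_
  set B := sqrt p * sqrt q + sqrt (1 - p) * sqrt (1 - q) with hB
  have hB1 : B ≤ 1 := bhatt_le_one hp hp1 hq hq1
  have hB0 : 0 ≤ B := bhatt_nonneg p q
  -- Bernoulli: 1 + 2m(B − 1) ≤ (1 + (B−1))^{2m} = B^{2m}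
  have hb := one_add_mul_le_pow (by linarith : (-2 : ℝ) ≤ B - 1) (2 * m)
  rw [show (1 : ℝ) + (B - 1) = B by ring, pow_mul] at hb
  have : (B ^ 2) ^ m = (B ^ m) ^ 2 := by ring
  rw [this] at hb
  push_cast at hb
  linarith

/-- **Sample-size corollary.** If some event has advantage `≥ γ > 0` then `γ² ≤ 2m(1 − BC)`, i.e.
`m ≥ γ²/(2(1 − BC(p,q)))` (Le Cam's two-point bound for coins).
[cite: GhosalVandervaart2017, Lemma B.1(i)] -/
theorem coin_samples_ge (m : ℕ) {p q γ : ℝ} (hp : 0 ≤ p) (hp1 : p ≤ 1) (hq : 0 ≤ q) (hq1 : q ≤ 1)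
    (E : Finset (Fin m → Bool)) (hγ : 0 ≤ γ)
    (hadv : γ ≤ |∑ x ∈ E, ∏ i, (if x i then p else 1 - p) -
      ∑ x ∈ E, ∏ i, (if x i then q else 1 - q)|) :
    γ ^ 2 ≤ 2 * m * (1 - (sqrt p * sqrt q + sqrt (1 - p) * sqrt (1 - q))) := by
  have h := coin_event_diff_sq_le_mul m hp hp1 hq hq1 E
  have h1 : γ ^ 2 ≤ (∑ x ∈ E, ∏ i, (if x i then p else 1 - p) -
      ∑ x ∈ E, ∏ i, (if x i then q else 1 - q)) ^ 2 := by
    rw [← sq_abs (∑ x ∈ E, _ - _)]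
    exact pow_le_pow_left₀ hγ hadv 2
  exact h1.trans h


/-- **Advantage `1/3` needs `m ≥ 1/(18(1 − BC))` tosses** (Le Cam's two-point bound for coins at
constant advantage). [cite: GhosalVandervaart2017, Lemma B.1(i)] -/
theorem coin_samples_ge_third (m : ℕ) {p q : ℝ} (hp : 0 ≤ p) (hp1 : p ≤ 1) (hq : 0 ≤ q)
    (hq1 : q ≤ 1) (E : Finset (Fin m → Bool))
    (hadv : (1 / 3 : ℝ) ≤ |∑ x ∈ E, ∏ i, (if x i then p else 1 - p) -
      ∑ x ∈ E, ∏ i, (if x i then q else 1 - q)|) :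
    1 ≤ 18 * m * (1 - (sqrt p * sqrt q + sqrt (1 - p) * sqrt (1 - q))) := by
  have h := coin_samples_ge m hp hp1 hq hq1 E (by norm_num) hadv
  nlinarith [h]

/-! ## The converse direction (ADDED v1.3): a count threshold tells Poisson trials apart with
`16·p·ln 3/(p − q)²` tosses

Chernoff's method for the number of heads `#x = #{i | x i}` of INDEPENDENT, not necessarily
identical trials with head probabilities `v i` (weights `∏ i, (if x i then v i else 1 − v i)`;
Motwani–Raghavan's «Poisson trials»): the exponential moment factorises,
`Σ_x w_v(x)·e^{s·#x} = ∏ i (v i·e^s + 1 − v i)` (independence), and is at most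
`exp(m·q·(e^s − 1))` when every `v i ≤ q` (`s ≥ 0`), resp. `Σ_x w_v(x)·e^{−s·#x} ≤ exp(m·p·(e^{−s} − 1))`
when every `v i ≥ p`; Markov's inequality, `1 + y ≤ e^y` and `e^u − 1 − u ≤ u²` (`|u| ≤ 1`) give
`P_v[#x ≥ t] ≤ exp(−st + mq(s + s²))` and `P_v[#x ≤ t] ≤ exp(st + mp(s² − s))`; at the middle
threshold `t = m(p + q)/2` with `s = (p − q)/(4q)` resp. `(p − q)/(4p)` both are at most
`exp(−m(p − q)²/(16p))` (`q < p ≤ 5q`), so `m ≥ 16·p·ln 3/(p − q)²` trials put each error below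
`1/3`: SOUNDNESS `P_v[#x ≥ t] ≤ 1/3` whenever all `v i ≤ q`, COMPLETENESS `P_v[#x ≥ t] ≥ 2/3`
whenever all `v i ≥ p`, and for two honest coins the count test has advantage `≥ 1/3` — the
converse of `coin_samples_ge_third` up to the constant (for `q < p ≤ 2q ≤ 1`,
`1 − BC(p,q) ≍ (p − q)²/p`). Motwani–Raghavan, §4.1 Theorems 4.1 and 4.2 (independent Poisson
trials, the moment generating function and Markov's inequality), in the finite-sum form of this file.
-/

/-- The weight of a toss sequence under independent trials with head probabilities `v i ∈ [0,1]`
is nonnegative. [folklore] -/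
private theorem trialWeight_nonneg {m : ℕ} {v : Fin m → ℝ} (hv0 : ∀ i, 0 ≤ v i) (hv1 : ∀ i, v i ≤ 1)
    (x : Fin m → Bool) : 0 ≤ ∏ i, (if x i then v i else 1 - v i) :=
  Finset.prod_nonneg fun i _ => by split_ifs <;> linarith [hv0 i, hv1 i]

/-- The trial weights are a probability vector: `Σ_x ∏ i (if x i then v i else 1 − v i) = 1`.
[cite: MotwaniRaghavan1995, §4.1 (independent Poisson trials)] -/
theorem sum_trialWeight_eq_one {m : ℕ} (v : Fin m → ℝ) :
    ∑ x : Fin m → Bool, ∏ i, (if x i then v i else 1 - v i) = 1 := by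
  have h := (Finset.prod_univ_sum (fun (_ : Fin m) => (univ : Finset Bool))
    (fun i b => if b then v i else 1 - v i))
  rw [Fintype.piFinset_univ] at h
  rw [← h]
  simp

/-- `e^{s·#x}` is the product of the per-toss factors `e^s` (heads) and `1` (tails).
[cite: MotwaniRaghavan1995, §4.1 (proof of Thm. 4.1: e^{tX} = Π e^{tX_i})] -/
theorem exp_mul_card_heads (m : ℕ) (s : ℝ) (x : Fin m → Bool) :
    exp (s * ((univ.filter fun i => x i = true).card : ℝ)) =
      ∏ i, (if x i = true then exp s else 1) := by
  symm
  calc ∏ i, (if x i = true then exp s else 1)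
      = ∏ _i ∈ univ.filter (fun i => x i = true), exp s := (Finset.prod_filter _ _).symm
    _ = exp s ^ (univ.filter fun i => x i = true).card := Finset.prod_const _
    _ = exp (s * ((univ.filter fun i => x i = true).card : ℝ)) := by
        rw [mul_comm, Real.exp_nat_mul]

/-- **The exponential moment of the number of heads factorises** (independence):
`Σ_x w_v(x)·e^{s·#x} = ∏ i (v i·e^s + (1 − v i))`.
[cite: MotwaniRaghavan1995, §4.1 (proof of Thm. 4.1: E[e^{tX}] = Π E[e^{tX_i}] = Π (1 + p_i(e^t − 1)))] -/
theorem sum_trialWeight_mul_exp {m : ℕ} (v : Fin m → ℝ) (s : ℝ) :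
    ∑ x : Fin m → Bool, (∏ i, (if x i then v i else 1 - v i)) *
        exp (s * ((univ.filter fun i => x i = true).card : ℝ)) = ∏ i, (v i * exp s + (1 - v i)) := by
  have h := (Finset.prod_univ_sum (fun (_ : Fin m) => (univ : Finset Bool))
    (fun i b => if b then v i * exp s else 1 - v i))
  rw [Fintype.piFinset_univ] at h
  have h' : ∏ i, (v i * exp s + (1 - v i)) =
      ∑ x : Fin m → Bool, ∏ i, (if x i then v i * exp s else 1 - v i) := by
    simpa using h
  rw [h']
  refine Finset.sum_congr rfl fun x _ => ?_
  rw [exp_mul_card_heads, ← Finset.prod_mul_distrib]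
  refine Finset.prod_congr rfl fun i _ => ?_
  split_ifs <;> ring

/-- `e^u − 1 ≤ u + u²` for `|u| ≤ 1`. [folklore] -/
private theorem exp_sub_one_le_add_sq {u : ℝ} (hu : |u| ≤ 1) : exp u - 1 ≤ u + u ^ 2 := by
  have h := (abs_le.1 (Real.abs_exp_sub_one_sub_id_le hu)).2
  linarith

/-- Upper bound of the factorised moment when every `v i ≤ q` and `s ≥ 0`:
`∏ i (v i·e^s + 1 − v i) ≤ exp(m·q·(e^s − 1))` (monotone in `v i`, then `1 + y ≤ e^y`).
[cite: MotwaniRaghavan1995, Theorem 4.1 (proof: Π(1 + p_i(e^t − 1)) ≤ Π e^{p_i(e^t − 1)})] -/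
theorem prod_trialMGF_le_exp {m : ℕ} {v : Fin m → ℝ} {q s : ℝ} (hv0 : ∀ i, 0 ≤ v i)
    (hvq : ∀ i, v i ≤ q) (hs : 0 ≤ s) :
    ∏ i, (v i * exp s + (1 - v i)) ≤ exp (m * (q * (exp s - 1))) := by
  have hes : 1 ≤ exp s := Real.one_le_exp hs
  calc ∏ i, (v i * exp s + (1 - v i)) ≤ ∏ _i : Fin m, exp (q * (exp s - 1)) := by
        refine Finset.prod_le_prod (fun i _ => by nlinarith [hv0 i]) fun i _ => ?_
        have h1 : v i * exp s + (1 - v i) ≤ 1 + q * (exp s - 1) := by nlinarith [hvq i]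
        have h2 := Real.add_one_le_exp (q * (exp s - 1))
        linarith
    _ = exp (m * (q * (exp s - 1))) := by
        rw [Finset.prod_const, Finset.card_univ, Fintype.card_fin, ← Real.exp_nat_mul]

/-- Lower-tail companion: when every `v i ∈ [p, 1]` and `s ≥ 0`,
`∏ i (v i·e^{−s} + 1 − v i) ≤ exp(m·p·(e^{−s} − 1))`.
[cite: MotwaniRaghavan1995, Theorem 4.2 (proof)] -/
theorem prod_trialMGF_neg_le_exp {m : ℕ} {v : Fin m → ℝ} {p s : ℝ} (hvp : ∀ i, p ≤ v i)
    (hv1 : ∀ i, v i ≤ 1) (hs : 0 ≤ s) :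
    ∏ i, (v i * exp (-s) + (1 - v i)) ≤ exp (m * (p * (exp (-s) - 1))) := by
  have hes : exp (-s) ≤ 1 := by rw [Real.exp_le_one_iff]; linarith
  have hep : 0 < exp (-s) := Real.exp_pos _
  calc ∏ i, (v i * exp (-s) + (1 - v i)) ≤ ∏ _i : Fin m, exp (p * (exp (-s) - 1)) := by
        refine Finset.prod_le_prod (fun i _ => by nlinarith [hv1 i, hvp i]) fun i _ => ?_
        have h1 : v i * exp (-s) + (1 - v i) ≤ 1 + p * (exp (-s) - 1) := by nlinarith [hvp i]
        have h2 := Real.add_one_le_exp (p * (exp (-s) - 1))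
        linarith
    _ = exp (m * (p * (exp (-s) - 1))) := by
        rw [Finset.prod_const, Finset.card_univ, Fintype.card_fin, ← Real.exp_nat_mul]

/-- **Upper tail by Chernoff's method**: for `s ≥ 0` and trials with `v i ∈ [0,1]`,
`P_v[#x ≥ t] ≤ e^{−st}·∏ i (v i·e^s + 1 − v i)`.
[cite: MotwaniRaghavan1995, Theorem 4.1 (proof: Markov on e^{tX})] -/
theorem trials_upperTail_le {m : ℕ} {v : Fin m → ℝ} (hv0 : ∀ i, 0 ≤ v i) (hv1 : ∀ i, v i ≤ 1)
    {s : ℝ} (hs : 0 ≤ s) (t : ℝ) :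
    ∑ x ∈ univ.filter (fun x : Fin m → Bool =>
        t ≤ ((univ.filter fun i => x i = true).card : ℝ)), ∏ i, (if x i then v i else 1 - v i) ≤
      exp (-(s * t)) * ∏ i, (v i * exp s + (1 - v i)) := by
  rw [← sum_trialWeight_mul_exp v s, Finset.mul_sum]
  calc ∑ x ∈ univ.filter (fun x : Fin m → Bool =>
          t ≤ ((univ.filter fun i => x i = true).card : ℝ)), ∏ i, (if x i then v i else 1 - v i)
      ≤ ∑ x ∈ univ.filter (fun x : Fin m → Bool =>
          t ≤ ((univ.filter fun i => x i = true).card : ℝ)),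
          exp (-(s * t)) * ((∏ i, (if x i then v i else 1 - v i)) *
            exp (s * ((univ.filter fun i => x i = true).card : ℝ))) := by
        refine Finset.sum_le_sum fun x hx => ?_
        simp only [Finset.mem_filter, Finset.mem_univ, true_and] at hx
        have h1 : 1 ≤ exp (-(s * t)) * exp (s * ((univ.filter fun i => x i = true).card : ℝ)) := by
          rw [← Real.exp_add]
          exact Real.one_le_exp (by nlinarith)
        have hw := trialWeight_nonneg hv0 hv1 x
        calc (∏ i, (if x i then v i else 1 - v i))
            = (∏ i, (if x i then v i else 1 - v i)) * 1 := (mul_one _).symm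
          _ ≤ (∏ i, (if x i then v i else 1 - v i)) *
              (exp (-(s * t)) * exp (s * ((univ.filter fun i => x i = true).card : ℝ))) :=
              mul_le_mul_of_nonneg_left h1 hw
          _ = _ := by ring
    _ ≤ ∑ x : Fin m → Bool, exp (-(s * t)) * ((∏ i, (if x i then v i else 1 - v i)) *
            exp (s * ((univ.filter fun i => x i = true).card : ℝ))) := by
        refine Finset.sum_le_sum_of_subset_of_nonneg (Finset.filter_subset _ _) fun x _ _ => ?_
        exact mul_nonneg (Real.exp_pos _).le
          (mul_nonneg (trialWeight_nonneg hv0 hv1 x) (Real.exp_pos _).le)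

/-- **Lower tail by Chernoff's method**: for `s ≥ 0` and trials with `v i ∈ [0,1]`,
`P_v[#x ≤ t] ≤ e^{st}·∏ i (v i·e^{−s} + 1 − v i)`.
[cite: MotwaniRaghavan1995, Theorem 4.2 (proof: Markov on e^{−tX})] -/
theorem trials_lowerTail_le {m : ℕ} {v : Fin m → ℝ} (hv0 : ∀ i, 0 ≤ v i) (hv1 : ∀ i, v i ≤ 1)
    {s : ℝ} (hs : 0 ≤ s) (t : ℝ) :
    ∑ x ∈ univ.filter (fun x : Fin m → Bool =>
        ((univ.filter fun i => x i = true).card : ℝ) ≤ t), ∏ i, (if x i then v i else 1 - v i) ≤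
      exp (s * t) * ∏ i, (v i * exp (-s) + (1 - v i)) := by
  rw [← sum_trialWeight_mul_exp v (-s), Finset.mul_sum]
  calc ∑ x ∈ univ.filter (fun x : Fin m → Bool =>
          ((univ.filter fun i => x i = true).card : ℝ) ≤ t), ∏ i, (if x i then v i else 1 - v i)
      ≤ ∑ x ∈ univ.filter (fun x : Fin m → Bool =>
          ((univ.filter fun i => x i = true).card : ℝ) ≤ t),
          exp (s * t) * ((∏ i, (if x i then v i else 1 - v i)) *
            exp (-s * ((univ.filter fun i => x i = true).card : ℝ))) := by
        refine Finset.sum_le_sum fun x hx => ?_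
        simp only [Finset.mem_filter, Finset.mem_univ, true_and] at hx
        have h1 : 1 ≤ exp (s * t) * exp (-s * ((univ.filter fun i => x i = true).card : ℝ)) := by
          rw [← Real.exp_add]
          exact Real.one_le_exp (by nlinarith)
        have hw := trialWeight_nonneg hv0 hv1 x
        calc (∏ i, (if x i then v i else 1 - v i))
            = (∏ i, (if x i then v i else 1 - v i)) * 1 := (mul_one _).symm
          _ ≤ (∏ i, (if x i then v i else 1 - v i)) *
              (exp (s * t) * exp (-s * ((univ.filter fun i => x i = true).card : ℝ))) :=
              mul_le_mul_of_nonneg_left h1 hw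
          _ = _ := by ring
    _ ≤ ∑ x : Fin m → Bool, exp (s * t) * ((∏ i, (if x i then v i else 1 - v i)) *
            exp (-s * ((univ.filter fun i => x i = true).card : ℝ))) := by
        refine Finset.sum_le_sum_of_subset_of_nonneg (Finset.filter_subset _ _) fun x _ _ => ?_
        exact mul_nonneg (Real.exp_pos _).le
          (mul_nonneg (trialWeight_nonneg hv0 hv1 x) (Real.exp_pos _).le)

/-- **Soundness of the count test.** Independent trials with head probabilities `v i ≤ q`
(`0 < q < p ≤ 5q`, `q ≤ 1`) reach the middle threshold `#x ≥ m(p + q)/2` with probability at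
most `1/3` once `m·(p − q)² ≥ 16·p·ln 3` (`s = (p − q)/(4q)`: exponent `−m(p − q)²/(16q) ≤ −ln 3`).
[cite: MotwaniRaghavan1995, Theorem 4.1] -/
theorem trials_count_upper_le_third {m : ℕ} {v : Fin m → ℝ} {p q : ℝ} (hq : 0 < q) (hqp : q < p)
    (hq1 : q ≤ 1) (h5 : p ≤ 5 * q) (hv0 : ∀ i, 0 ≤ v i) (hvq : ∀ i, v i ≤ q)
    (hm : 16 * p * Real.log 3 ≤ m * (p - q) ^ 2) :
    ∑ x ∈ univ.filter (fun x : Fin m → Bool =>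
        (m : ℝ) * (p + q) / 2 ≤ ((univ.filter fun i => x i = true).card : ℝ)),
        ∏ i, (if x i then v i else 1 - v i) ≤ 1 / 3 := by
  have hv1 : ∀ i, v i ≤ 1 := fun i => (hvq i).trans hq1
  set s : ℝ := (p - q) / (4 * q) with hs_def
  have hs0 : 0 ≤ s := by rw [hs_def]; exact div_nonneg (by linarith) (by linarith)
  have hs1 : s ≤ 1 := by rw [hs_def, div_le_one (by linarith)]; linarith
  have hlog : 0 < Real.log 3 := Real.log_pos (by norm_num)
  refine le_trans (trials_upperTail_le hv0 hv1 hs0 _) ?_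
  have h2 : ∏ i, (v i * exp s + (1 - v i)) ≤ exp (m * (q * (exp s - 1))) :=
    prod_trialMGF_le_exp hv0 hvq hs0
  have h3 : exp (m * (q * (exp s - 1))) ≤ exp (m * (q * (s + s ^ 2))) := by
    refine Real.exp_le_exp.2 (mul_le_mul_of_nonneg_left ?_ (Nat.cast_nonneg _))
    exact mul_le_mul_of_nonneg_left (exp_sub_one_le_add_sq (by rw [abs_le]; constructor <;> linarith))
      hq.le
  have hexp : -(s * ((m : ℝ) * (p + q) / 2)) + m * (q * (s + s ^ 2)) =
      -((m : ℝ) * (p - q) ^ 2 / (16 * q)) := by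
    rw [hs_def]; field_simp; ring
  have hkey : (m : ℝ) * (p - q) ^ 2 / (16 * q) ≥ Real.log 3 := by
    rw [ge_iff_le, le_div_iff₀ (by linarith)]
    nlinarith [mul_nonneg (Nat.cast_nonneg m : (0 : ℝ) ≤ m) (sq_nonneg (p - q))]
  have h4 : exp (-(Real.log 3)) = 1 / 3 := by
    rw [Real.exp_neg, Real.exp_log (by norm_num)]; norm_num
  calc exp (-(s * ((m : ℝ) * (p + q) / 2))) * ∏ i, (v i * exp s + (1 - v i))
      ≤ exp (-(s * ((m : ℝ) * (p + q) / 2))) * exp (m * (q * (s + s ^ 2))) :=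
        mul_le_mul_of_nonneg_left (h2.trans h3) (Real.exp_pos _).le
    _ = exp (-((m : ℝ) * (p - q) ^ 2 / (16 * q))) := by rw [← Real.exp_add, hexp]
    _ ≤ exp (-(Real.log 3)) := Real.exp_le_exp.2 (by linarith)
    _ = 1 / 3 := h4

/-- **Completeness of the count test (lower tail).** Independent trials with head probabilities
`v i ∈ [p, 1]` (`0 < q < p`) fall to or below the middle threshold with probability at most `1/3`
once `m·(p − q)² ≥ 16·p·ln 3` (`s = (p − q)/(4p)`: exponent `−m(p − q)²/(16p) ≤ −ln 3`).
[cite: MotwaniRaghavan1995, Theorem 4.2] -/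
theorem trials_count_lower_le_third {m : ℕ} {v : Fin m → ℝ} {p q : ℝ} (hq : 0 < q) (hqp : q < p)
    (hvp : ∀ i, p ≤ v i) (hv1 : ∀ i, v i ≤ 1)
    (hm : 16 * p * Real.log 3 ≤ m * (p - q) ^ 2) :
    ∑ x ∈ univ.filter (fun x : Fin m → Bool =>
        ((univ.filter fun i => x i = true).card : ℝ) ≤ (m : ℝ) * (p + q) / 2),
        ∏ i, (if x i then v i else 1 - v i) ≤ 1 / 3 := by
  have hp : 0 < p := hq.trans hqp
  have hv0 : ∀ i, 0 ≤ v i := fun i => hp.le.trans (hvp i)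
  set s : ℝ := (p - q) / (4 * p) with hs_def
  have hs0 : 0 ≤ s := by rw [hs_def]; exact div_nonneg (by linarith) (by linarith)
  have hs1 : s ≤ 1 := by rw [hs_def, div_le_one (by linarith)]; linarith
  have hlog : 0 < Real.log 3 := Real.log_pos (by norm_num)
  refine le_trans (trials_lowerTail_le hv0 hv1 hs0 _) ?_
  have h2 : ∏ i, (v i * exp (-s) + (1 - v i)) ≤ exp (m * (p * (exp (-s) - 1))) :=
    prod_trialMGF_neg_le_exp hvp hv1 hs0
  have h3 : exp (m * (p * (exp (-s) - 1))) ≤ exp (m * (p * (-s + (-s) ^ 2))) := by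
    refine Real.exp_le_exp.2 (mul_le_mul_of_nonneg_left ?_ (Nat.cast_nonneg _))
    exact mul_le_mul_of_nonneg_left (exp_sub_one_le_add_sq (by rw [abs_le]; constructor <;> linarith))
      hp.le
  have hexp : s * ((m : ℝ) * (p + q) / 2) + m * (p * (-s + (-s) ^ 2)) =
      -((m : ℝ) * (p - q) ^ 2 / (16 * p)) := by
    rw [hs_def]; field_simp; ring
  have hkey : (m : ℝ) * (p - q) ^ 2 / (16 * p) ≥ Real.log 3 := by
    rw [ge_iff_le, le_div_iff₀ (by linarith)]
    nlinarith
  have h4 : exp (-(Real.log 3)) = 1 / 3 := by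
    rw [Real.exp_neg, Real.exp_log (by norm_num)]; norm_num
  calc exp (s * ((m : ℝ) * (p + q) / 2)) * ∏ i, (v i * exp (-s) + (1 - v i))
      ≤ exp (s * ((m : ℝ) * (p + q) / 2)) * exp (m * (p * (-s + (-s) ^ 2))) :=
        mul_le_mul_of_nonneg_left (h2.trans h3) (Real.exp_pos _).le
    _ = exp (-((m : ℝ) * (p - q) ^ 2 / (16 * p))) := by rw [← Real.exp_add, hexp]
    _ ≤ exp (-(Real.log 3)) := Real.exp_le_exp.2 (by linarith)
    _ = 1 / 3 := h4

/-- **Completeness of the count test.** Independent trials with head probabilities `v i ∈ [p, 1]`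
pass the middle threshold `#x ≥ m(p + q)/2` with probability at least `2/3` once
`m·(p − q)² ≥ 16·p·ln 3`. [cite: MotwaniRaghavan1995, Theorem 4.2] -/
theorem trials_count_pass_ge_two_thirds {m : ℕ} {v : Fin m → ℝ} {p q : ℝ} (hq : 0 < q)
    (hqp : q < p) (hvp : ∀ i, p ≤ v i) (hv1 : ∀ i, v i ≤ 1)
    (hm : 16 * p * Real.log 3 ≤ m * (p - q) ^ 2) :
    (2 / 3 : ℝ) ≤ ∑ x ∈ univ.filter (fun x : Fin m → Bool =>
        (m : ℝ) * (p + q) / 2 ≤ ((univ.filter fun i => x i = true).card : ℝ)),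
        ∏ i, (if x i then v i else 1 - v i) := by
  have hv0 : ∀ i, 0 ≤ v i := fun i => (hq.trans hqp).le.trans (hvp i)
  have hL := trials_count_lower_le_third hq hqp hvp hv1 hm
  have htot := Finset.sum_filter_add_sum_filter_not (univ : Finset (Fin m → Bool))
    (fun x : Fin m → Bool => (m : ℝ) * (p + q) / 2 ≤ ((univ.filter fun i => x i = true).card : ℝ))
    (fun x => ∏ i, (if x i then v i else 1 - v i))
  rw [sum_trialWeight_eq_one v] at htot
  have hC : ∑ x ∈ univ.filter (fun x : Fin m → Bool =>
      ¬ ((m : ℝ) * (p + q) / 2 ≤ ((univ.filter fun i => x i = true).card : ℝ))),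
        ∏ i, (if x i then v i else 1 - v i) ≤ 1 / 3 := by
    refine le_trans (Finset.sum_le_sum_of_subset_of_nonneg ?_ fun x _ _ =>
      trialWeight_nonneg hv0 hv1 x) hL
    intro x hx
    simp only [Finset.mem_filter, Finset.mem_univ, true_and, not_le] at hx ⊢
    exact hx.le
  linarith

/-- **How many tosses suffice (two coins, counting form, constant advantage).** For
`0 < q < p ≤ 5q`, `p ≤ 1` and `m ≥ 16·p·ln 3/(p − q)²`, the middle-threshold count test has
advantage at least `1/3` between `m` tosses of the `p`-coin and of the `q`-coin — the converse of
`coin_samples_ge_third` up to the constant. [cite: MotwaniRaghavan1995, §4.1 Theorems 4.1, 4.2] -/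
theorem coin_count_advantage_ge_third (m : ℕ) {p q : ℝ} (hq : 0 < q) (hqp : q < p) (hp1 : p ≤ 1)
    (h5 : p ≤ 5 * q) (hm : 16 * p * Real.log 3 ≤ m * (p - q) ^ 2) :
    (1 / 3 : ℝ) ≤
      ∑ x ∈ univ.filter (fun x : Fin m → Bool =>
          (m : ℝ) * (p + q) / 2 ≤ ((univ.filter fun i => x i = true).card : ℝ)),
          ∏ i, (if x i then p else 1 - p) -
        ∑ x ∈ univ.filter (fun x : Fin m → Bool =>
          (m : ℝ) * (p + q) / 2 ≤ ((univ.filter fun i => x i = true).card : ℝ)),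
          ∏ i, (if x i then q else 1 - q) := by
  have hq1 : q ≤ 1 := by linarith
  have hU := trials_count_upper_le_third (v := fun _ => q) hq hqp hq1 h5 (fun _ => hq.le)
    (fun _ => le_rfl) hm
  have hP := trials_count_pass_ge_two_thirds (v := fun _ => p) hq hqp (fun _ => le_rfl)
    (fun _ => hp1) hm
  linarith

end Literature.Computability.Complexity
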